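import Summits.BirchSwinnertonDyer.BirchSwinnertonDyer.Theorems.Rank1ResidualJetCebotarevAdapter
import Summits.BirchSwinnertonDyer.Rank1Residual.X10.LeafDischargeX10bKolyvagin
import Summits.BirchSwinnertonDyer.BirchSwinnertonDyer.Theorems.ClassRecordThreeShimuraKolyvaginFixedOfTorsion
import HarnessLib

/-!
# Class X9 / X10b: the DISCHARGE INTERFACE for Jetchev's Lemma 6.1 WITH LEVEL SHIFT (classes of level
# `p^M`, Kolyvagin primes of DEPTH `M + k`) on Heegner frames — the `h61` input of the CORE-VERTEX
# WALK (Jetchev 2008 Prop. 5.3 / 6.4), UNCONDITIONALLY, from the scalar form (Z) (no `−1 ∈ image`)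

Print-tier cell `bsd-print-x9` (D-0131 (2), key `x9`), typer seat ty2, file J of the discharge
interface (F = `X9/LeafDischargeKolyvaginCebotarev`, H = `X9/LeafDischargeKolyvaginH61`,
I = `X10/LeafDischargeX10bKolyvagin`). Theorems only (D-0014 / D-0026); nothing here is a class theorem.

WHY. The kernel walks producing Jetchev's CORE VERTICES (bsd-jet `JET.exists_coreVertex_of_orderedFamilies`
→ `JET.jetchevCoreVertexExistence_lt_of_namedPrint`; bsd-stepL `Koly.tamagawaExponent_le_m_of_…Families`)
choose Kolyvagin primes of index `≥ k + m(c)` by Lemma 6.1 for classes of LEVEL `p^k`: level and depth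
are DECOUPLED. Their one Galois-image input is `Koly.exists_kolyvaginPrime_addOrderOf_localization_eq_shift`
(tam3-p1; `ρ̄_{E,p}` ONTO); irreducible twins exist only WITH `−1 ∈ ρ̄(Γ_ℚ)` (corner-p1
`…_shift_of_irr_of_neg`; false in general at `p = 7`, Zywina's `H_{1,1}`) or with `p ∣ N_E ∧ ¬CM`
(k9-c4 `JetchevIrreducibleCoreVertex.…_shift_of_irreducible_of_heegner`; on X9/X10b `p` is GOOD).
Files F/H give the ONE-LEVEL Lemma 6.1 on X9/X10b frames from (Z); this file adds the shift, so the
core-vertex walk of crux J = `HeegnerDivisibilityX9` (stmt-BirchSwinnertonDyer-20392, `stub_jetchevX9`)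
and of the X10b Heegner road at `3` (crux J₃) reads its `h61` BY NAME, at `p = 5, 7, 3`, no certificate.

1. `cor32_localOrder_shift_of_cor32Frame` (image-free adapter) — `E(K)[p] = 0` + McCallum Cor. 3.2 at
   level `p^{M+k}` in Zhang's currency on the frame (`h32F`, the shape concluded by F /
   `JetchevIrreducibleCebotarev.cor32_localOrder_of_image`) ⟹ Cor. 3.2 for `c`-eigenclasses in
   `H¹(K, E[p^M])` with primes of DEPTH `M + k`. Proof = shim-p1's level shift
   (`…InertShiftCebotarev` §1–§4): `ι_*` injective from `E(K)[p] = 0`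
   (`ShimuraKolyvaginFixedOfTorsion.torsionH1OfDvd_pow_injective_of_torsionBy_eq_bot`), `h32F` on
   `ι_* c_i`, `Γ_{K_λ}` fixes `E[p^{M+k}]` above the bad places (`absGaloisRestrict_smul_geomTorsion_eq_of_kolyvaginPrime`,
   `mem_torsionLocalKer_iff_torsionH1OfDvd_mem`).
2. `exists_kolyvaginPrime_addOrderOf_localization_eq_shift_of_cor32ShiftFrame` (image-free adapter) —
   from 1's conclusion (`h32S`) to the walk's `h61` currency (file H's one-level adapter over `h32S`).
3. **`ClassX9.cor32_localOrder_shift_of_heegner`**, **`ClassX9.exists_kolyvaginPrime_addOrderOf_localization_eq_shift_of_heegner`**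
   — on every X9 Heegner frame (`K` imaginary quadratic, Heegner hypothesis for `N_E`, `p` split),
   UNCONDITIONAL; 4. `ClassX10.…` — the X10b twins at `p = 3`.

## References

* [Jetchev2008] D. Jetchev, Compos. Math. 144 (2008), Lemma 5.1 (p. 821) (= arXiv Lemma 6.1),
  Rem. 6.2, Prop. 5.3, §6.2.
* [McCallumLMS1991] W. G. McCallum, LMS LN 153 (1991), §3 Prop. 3.1, Cor. 3.2 (pp. 298–299), §4 Lemma 4.6.
* [GrossLMS1991] B. H. Gross, LMS LN 153 (1991), §3 (3.1)–(3.3), Lemma 4.3, §9.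
* [Howard2004Duke] B. Howard, Compos. Math. 140 (2004), Thm. 3.2.2 (proof: primes one level deeper).
* [WZhang2014] W. Zhang, Camb. J. Math. 2 (2014), Notations (xii).
presearch (D-0021): `lean search 'cor32_pow_shift|localization_eq_shift' --decl` → tam3-p1 / shim-p1
(surjective), corner-p1 (`−1 ∈ image`), k9-c4 (`p ∣ N_E`); none from (Z) with `p` good and split.
-/

set_option autoImplicit false

noncomputable section

open scoped Classical Pointwise NumberField

open WeierstrassCurve NumberField IsDedekindDomain Field
  Literature.NumberTheory.EllipticCurves Literature.NumberTheory.GaloisRepresentations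
  Summit.BirchSwinnertonDyer.Rank1Residual Summit.BirchSwinnertonDyer.Rank1Residual.JET
  Summit.BirchSwinnertonDyer.BirchSwinnertonDyer.Theorems

namespace Literature.NumberTheory.EllipticCurves.Rank1Residual

/-! ### 1. McCallum's Cor. 3.2 one level deeper, from a per-frame Cor. 3.2 and `E(K)[p] = 0` -/

section Frame

/-- **[McC] Cor. 3.2 ONE LEVEL DEEPER on a frame** (image-free adapter): for `W/ℚ` globally minimal,
`K` imaginary quadratic with `E(K)[p] = 0`, `c ∈ Aut(K/ℚ)`, `M ≥ 1`, and McCallum's Cor. 3.2 at level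
`p^{M+k}` in Zhang's currency on this frame (`h32F`): for non-zero independent `c`-eigenclasses
`c_i ∈ H¹(K, E[p^M])` of orders `p^{M_i}` and `N_i ≤ M_i`, the set of primes `ℓ` with
`Frob ℓ = Frob ∞` on `E[p^{M+k}]`, `ℓ` a Zhang–Kolyvagin prime (level `N`) of index `≥ M + k`, and
`p^j c_{i,λ} = 0 ↔ N_i ≤ j` at `λ ∋ ℓ`, is INFINITE. = shim-p1's `McCallum1991_cor_3_2_pow_shift_of_chebotarev`
/ k9-c4's `JetchevIrreducibleCoreVertex.cor32_localOrder_shift_of_irreducible_of_heegner` with the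
level-`p^{M+k}` theorem replaced by `h32F`. [cite: McCallumLMS1991, §3 Cor. 3.2, §4 Lemma 4.6]
[cite: Howard2004Duke, Thm. 3.2.2 (proof)] [cite: GrossLMS1991, Lemma 4.3, §9] -/
theorem cor32_localOrder_shift_of_cor32Frame (N : ℕ) [NeZero N] (W : WeierstrassCurve ℚ)
    [W.IsElliptic] [W.IsGloballyMinimal] (K : Type) [Field K] [NumberField K]
    (hK : IsImaginaryQuadratic K) (p : ℕ) (hp : p.Prime)
    (hbot : AddSubgroup.torsionBy (W.baseChange K).toAffine.Point (p : ℤ) = ⊥)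
    (c : K ≃ₐ[ℚ] K) (M : ℕ) (hM : 1 ≤ M) (k : ℕ)
    (h32F : ∀ (r : ℕ) (cs : Fin r → galH1Torsion (W.baseChange K) ((p ^ (M + k) : ℕ) : ℤ)),
        (∀ i, cs i ≠ 0) →
        (∀ i, ∃ e : ℤ, (e = 1 ∨ e = -1) ∧ conjAct W c ((p ^ (M + k) : ℕ) : ℤ) (cs i) = e • cs i) →
        (∀ a : Fin r → ℤ, ∑ i, a i • cs i = 0 → ∀ i, (addOrderOf (cs i) : ℤ) ∣ a i) →
        ∀ (Mi : Fin r → ℕ), (∀ i, addOrderOf (cs i) = p ^ Mi i) →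
        ∀ (Nv : Fin r → ℕ), (∀ i, Nv i ≤ Mi i) →
          Set.Infinite {ℓ : ℕ | FrobEqFrobInfty W K (p ^ (M + k)) ℓ ∧
            Zhang2014.IsKolyvaginPrime N W K p ℓ ∧ M + k ≤ Zhang2014.kolyvaginIndex W p ℓ ∧
            ∀ i, ∀ v : HeightOneSpectrum (𝓞 K), (ℓ : 𝓞 K) ∈ v.asIdeal →
              ∀ j : ℕ, ((p ^ j : ℕ) : ℤ) • cs i ∈
                  (W.baseChange K).torsionLocalKer (v.adicCompletion K) ((p ^ (M + k) : ℕ) : ℤ) ↔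
                Nv i ≤ j})
    (r : ℕ) (cs : Fin r → galH1Torsion (W.baseChange K) ((p ^ M : ℕ) : ℤ)) (h0 : ∀ i, cs i ≠ 0)
    (hτ : ∀ i, ∃ e : ℤ, (e = 1 ∨ e = -1) ∧ conjAct W c ((p ^ M : ℕ) : ℤ) (cs i) = e • cs i)
    (hind : ∀ b : Fin r → ℤ, ∑ i, b i • cs i = 0 → ∀ i, (addOrderOf (cs i) : ℤ) ∣ b i)
    (Mi : Fin r → ℕ) (hMi : ∀ i, addOrderOf (cs i) = p ^ Mi i) (Nv : Fin r → ℕ) (hNv : ∀ i, Nv i ≤ Mi i) :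
    Set.Infinite {ℓ : ℕ | FrobEqFrobInfty W K (p ^ (M + k)) ℓ ∧
      Zhang2014.IsKolyvaginPrime N W K p ℓ ∧ M + k ≤ Zhang2014.kolyvaginIndex W p ℓ ∧
      ∀ i, ∀ v : HeightOneSpectrum (𝓞 K), (ℓ : 𝓞 K) ∈ v.asIdeal →
        ∀ j : ℕ, ((p ^ j : ℕ) : ℤ) • cs i ∈
            (W.baseChange K).torsionLocalKer (v.adicCompletion K) ((p ^ M : ℕ) : ℤ) ↔ Nv i ≤ j} := by
  classical
  haveI : (W.baseChange K).IsElliptic := inferInstanceAs (W.map (algebraMap ℚ K)).IsElliptic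
  have hdvd := natCast_pow_dvd_natCast_pow_add p M k
  set ι := torsionH1OfDvd (W.baseChange K) hdvd with hιdef
  -- injectivity of the level change from `E(K)[p] = 0`
  have hιinj : Function.Injective ι :=
    ShimuraKolyvaginFixedOfTorsion.torsionH1OfDvd_pow_injective_of_torsionBy_eq_bot W hbot M k
  -- ### the shifted classes `ι_* c_i ∈ H¹(K, E[p^{M+k}])`
  set cs' : Fin r → galH1Torsion (W.baseChange K) ((p ^ (M + k) : ℕ) : ℤ) := fun i ↦ ι (cs i)
    with hcs'
  have h0' : ∀ i, cs' i ≠ 0 := fun i h ↦ h0 i (hιinj (by rw [map_zero]; exact h))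
  have hτ' : ∀ i, ∃ e : ℤ, (e = 1 ∨ e = -1) ∧
      conjAct W c ((p ^ (M + k) : ℕ) : ℤ) (cs' i) = e • cs' i := fun i ↦ by
    obtain ⟨e, he, hec⟩ := hτ i
    exact ⟨e, he, by rw [hcs', conjAct_torsionH1OfDvd, hec, map_zsmul]⟩
  have hord' : ∀ i, addOrderOf (cs' i) = addOrderOf (cs i) := fun i ↦ by
    refine (addOrderOf_injective (AddMonoidHom.mk' (fun x ↦ ι x) (fun x y ↦ map_add ι x y)) ?_ (cs i))
    intro x y hxy
    exact hιinj hxy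
  have hind' : ∀ b : Fin r → ℤ, ∑ i, b i • cs' i = 0 → ∀ i, (addOrderOf (cs' i) : ℤ) ∣ b i := by
    intro b hb i
    have hsum : ι (∑ j, b j • cs j) = 0 := by
      rw [map_sum]
      simpa only [map_zsmul] using hb
    rw [hord']
    exact hind b (hιinj (by rw [hsum, map_zero])) i
  have hMi' : ∀ i, addOrderOf (cs' i) = p ^ Mi i := fun i ↦ (hord' i).trans (hMi i)
  -- ### the bound: above the rational primes under the bad places of `E/K`
  have hbad : ((W.baseChange K).badPlaces (𝓞 K)).Finite := (W.baseChange K).finite_badPlaces_holds (𝓞 K)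
  set B : ℕ := hbad.toFinset.sup fun w ↦ (Rat.HeightOneSpectrum.primesEquiv (w.under (𝓞 ℚ)) : ℕ)
    with hB
  -- ### the frame's Cor. 3.2 at level `p^{M+k}`
  have hinf := h32F r cs' h0' hτ' hind' Mi hMi' Nv hNv
  refine (hinf.sdiff (Set.finite_le_nat B)).mono ?_
  rintro ℓ ⟨⟨hfrob, hZ, hidx, hloc⟩, hBℓ⟩
  have hBℓ' : B < ℓ := lt_of_not_ge hBℓ
  -- the Gross–Kolyvagin structure of `ℓ` (for the place API): `Frob ℓ = Frob ∞` on `E[p] ⊆ E[p^{M+k}]`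
  have hMk : M + k ≠ 0 := by omega
  have hKol : IsKolyvaginPrime N W K p ℓ :=
    ⟨hZ.1, hZ.2.1, hZ.2.2.1, hZ.2.2.2.1, hZ.2.2.2.2.1, hfrob.of_dvd (dvd_pow_self p hMk)⟩
  -- ### good reduction at `λ`
  have hgood : hKol.place ∉ (W.baseChange K).badPlaces (𝓞 K) := by
    intro hmem
    have hle : (Rat.HeightOneSpectrum.primesEquiv (hKol.place.under (𝓞 ℚ)) : ℕ) ≤ B :=
      Finset.le_sup (f := fun w : HeightOneSpectrum (𝓞 K) ↦
        (Rat.HeightOneSpectrum.primesEquiv (w.under (𝓞 ℚ)) : ℕ)) (hbad.mem_toFinset.mpr hmem)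
    have hℓeq : (Rat.HeightOneSpectrum.primesEquiv (hKol.place.under (𝓞 ℚ)) : ℕ) = ℓ := by
      rw [(natCast_mem_asIdeal_iff_eq_primesEquiv_symm _ hKol.prime).mp hKol.natCast_mem_under,
        Equiv.apply_symm_apply]
    omega
  -- ### `Γ_{K_λ}` fixes `E[p^{M+k}]`
  haveI : NeZero (p ^ (M + k)) := ⟨pow_ne_zero _ hp.ne_zero⟩
  have hpv : ((p : ℕ) : 𝓞 K) ∉ hKol.place.asIdeal :=
    not_natCast_mem_of_prime_ne hKol.prime hp hKol.2.2.2.1 hKol.place hKol.mem_place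
  have hqv : ((((p ^ (M + k) : ℕ) : ℤ)) : 𝓞 K) ∉ hKol.place.asIdeal := by
    rw [Int.cast_natCast, Nat.cast_pow]
    exact fun h ↦ hpv (hKol.place.isPrime.mem_of_pow_mem (M + k) h)
  have htriv : ∀ (g : absoluteGaloisGroup (hKol.place.adicCompletion K))
      (Q : geomTorsion (W.baseChange K) ((p ^ (M + k) : ℕ) : ℤ)),
      resGal (K := K) (hKol.place.adicCompletion K) g • Q = Q := fun g Q ↦ by
    rw [resGal_eq_absGaloisRestrict]
    exact absGaloisRestrict_smul_geomTorsion_eq_of_kolyvaginPrime W hK hKol hfrob hgood hqv g Q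
  -- ### assemble
  refine ⟨hfrob, hZ, hidx, fun i v hv j ↦ ?_⟩
  rw [hKol.mem_iff.mp hv]
  have key := hloc i hKol.place hKol.mem_place j
  have hpd : p ^ M ∣ p ^ (M + k) := pow_dvd_pow p (Nat.le_add_right M k)
  have hpM : p ^ M ≠ 0 := pow_ne_zero M hp.ne_zero
  have hpMk : p ^ (M + k) ≠ 0 := pow_ne_zero _ hp.ne_zero
  have e1 := mem_torsionLocalKer_iff_torsionH1OfDvd_mem (W.baseChange K) (hKol.place.adicCompletion K)
    hpd hpM hpMk htriv (((p ^ j : ℕ) : ℤ) • cs i)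
  rw [map_zsmul] at e1
  exact e1.trans key

/-! ### 2. From the shifted Cor. 3.2 to the walk's `h61` (localisation currency) -/

/-- **[J] Lemma 6.1 (= [McC] Cor. 3.2) DECOUPLED in the walk's localisation currency, from a per-frame
SHIFTED Cor. 3.2** (`h32S` = the conclusion of `cor32_localOrder_shift_of_cor32Frame` for `N = N_E`;
image-free adapter): for `τ`-eigenclasses `x` (sign `e`) and `y ≠ 0` (sign `−e`) in `H¹(K, E[p^k])`
and any bound `b`, a Zhang–Kolyvagin prime `ℓ > b` of index `M(ℓ) ≥ k + j` whose localisation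
PRESERVES the orders of `x` and `y` — the `h61` shape of `JET.exists_coreVertex_of_orderedFamilies` /
`Koly.tamagawaExponent_le_m_of_…Families`. Proof = file H's one-level adapter over `h32S`
(`JET.dvd_of_zsmul_add_zsmul_eq_zero_of_eigen`, `JET.addOrderOf_map_eq_of_forall_map_nsmul_eq_zero_iff`).
[cite: Jetchev2008, Lemma 5.1 (p. 821), Rem. 6.2] [cite: McCallumLMS1991, §3 Cor. 3.2 (p. 299), §4 Lemma 4.6] -/
theorem exists_kolyvaginPrime_addOrderOf_localization_eq_shift_of_cor32ShiftFrame
    (W : WeierstrassCurve ℚ) [W.IsElliptic] [W.IsGloballyMinimal]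
    (K : Type) [Field K] [NumberField K]
    (p : ℕ) [Fact p.Prime] (hp2 : p ≠ 2) (τ : K ≃ₐ[ℚ] K) {k : ℕ} (j : ℕ)
    (h32S : ∀ (r : ℕ) (cs : Fin r → galH1Torsion (W.baseChange K) ((p ^ k : ℕ) : ℤ)),
        (∀ i, cs i ≠ 0) →
        (∀ i, ∃ e : ℤ, (e = 1 ∨ e = -1) ∧ conjAct W τ ((p ^ k : ℕ) : ℤ) (cs i) = e • cs i) →
        (∀ a : Fin r → ℤ, ∑ i, a i • cs i = 0 → ∀ i, (addOrderOf (cs i) : ℤ) ∣ a i) →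
        ∀ (Mi : Fin r → ℕ), (∀ i, addOrderOf (cs i) = p ^ Mi i) →
        ∀ (Nv : Fin r → ℕ), (∀ i, Nv i ≤ Mi i) →
          Set.Infinite {ℓ : ℕ | FrobEqFrobInfty W K (p ^ (k + j)) ℓ ∧
            Zhang2014.IsKolyvaginPrime (W.conductorNorm ℤ) W K p ℓ ∧
            k + j ≤ Zhang2014.kolyvaginIndex W p ℓ ∧
            ∀ i, ∀ v : HeightOneSpectrum (𝓞 K), (ℓ : 𝓞 K) ∈ v.asIdeal →
              ∀ j' : ℕ, ((p ^ j' : ℕ) : ℤ) • cs i ∈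
                  (W.baseChange K).torsionLocalKer (v.adicCompletion K) ((p ^ k : ℕ) : ℤ) ↔ Nv i ≤ j'})
    {e : ℤ} (he : e = 1 ∨ e = -1)
    (x y : galH1Torsion (W.baseChange K) ((p ^ k : ℕ) : ℤ))
    (hx : conjAct W τ ((p ^ k : ℕ) : ℤ) x = e • x) (hy : conjAct W τ ((p ^ k : ℕ) : ℤ) y = (-e) • y)
    (hy0 : y ≠ 0) (b : ℕ) :
    ∃ ℓ : ℕ, b < ℓ ∧ Zhang2014.IsKolyvaginPrime (W.conductorNorm ℤ) W K p ℓ ∧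
      k + j ≤ Zhang2014.kolyvaginIndex W p ℓ ∧
      ∀ v : HeightOneSpectrum (𝓞 K), (ℓ : 𝓞 K) ∈ v.asIdeal →
        addOrderOf (galoisCohomology.localization
            ((W.baseChange K).torsionGaloisModule ((p ^ k : ℕ) : ℤ)) (Sum.inr v) 1 x) = addOrderOf x ∧
        addOrderOf (galoisCohomology.localization
            ((W.baseChange K).torsionGaloisModule ((p ^ k : ℕ) : ℤ)) (Sum.inr v) 1 y) = addOrderOf y := by
  have hp : p.Prime := Fact.out
  -- every class is killed by `p^k`, so orders are powers of `p` (and prime to `2`)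
  have hkill : ∀ z : galH1Torsion (W.baseChange K) ((p ^ k : ℕ) : ℤ), p ^ k • z = 0 := fun z ↦
    galoisCohomology.nsmul_eq_zero_of_forall ((W.baseChange K).torsionGaloisModule ((p ^ k : ℕ) : ℤ))
      (fun T ↦ by
        have h := (W.baseChange K).natAbs_nsmul_geomTorsion T
        rwa [Int.natAbs_natCast] at h) z
  have hordpow : ∀ z : galH1Torsion (W.baseChange K) ((p ^ k : ℕ) : ℤ), ∃ a ≤ k, addOrderOf z = p ^ a :=
    fun z ↦ (Nat.dvd_prime_pow hp).mp (addOrderOf_dvd_of_nsmul_eq_zero (hkill z))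
  have hcop2 : ∀ z : galH1Torsion (W.baseChange K) ((p ^ k : ℕ) : ℤ), (addOrderOf z).Coprime 2 := by
    intro z
    obtain ⟨a, -, ha⟩ := hordpow z
    rw [ha]
    exact Nat.Coprime.pow_left _ ((Nat.coprime_primes hp Nat.prime_two).mpr hp2)
  -- the localisation at the place `v`, typed on `galH1Torsion` (= `galoisCohomology _ 1` by `rfl`)
  let loc : ∀ v : HeightOneSpectrum (𝓞 K), galH1Torsion (W.baseChange K) ((p ^ k : ℕ) : ℤ) →+
      galoisCohomology (((W.baseChange K).torsionGaloisModule ((p ^ k : ℕ) : ℤ)).toLocal (Sum.inr v)) 1 :=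
    fun v ↦ galoisCohomology.localization ((W.baseChange K).torsionGaloisModule ((p ^ k : ℕ) : ℤ))
      (Sum.inr v) 1
  -- dictionary: multiples in `torsionLocalKer` = multiples killed by the localisation
  have hloc : ∀ (v : HeightOneSpectrum (𝓞 K)) (z : galH1Torsion (W.baseChange K) ((p ^ k : ℕ) : ℤ))
      (a : ℕ), loc v (p ^ a • z) = 0 ↔
        ((p ^ a : ℕ) : ℤ) • z ∈ (W.baseChange K).torsionLocalKer (v.adicCompletion K) ((p ^ k : ℕ) : ℤ) := by
    intro v z a
    haveI : CharZero (v.adicCompletion K) := charZero_of_injective_algebraMap (algebraMap K _).injective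
    rw [natCast_zsmul, mem_torsionLocalKer_iff_res_eq_zero (W := W.baseChange K)
      (E := v.adicCompletion K) (pow_ne_zero k hp.ne_zero)]
    exact Iff.rfl
  obtain ⟨b', -, hb'⟩ := hordpow y
  have hey : (-e = 1 ∨ -e = -1) := by rcases he with rfl | rfl <;> norm_num
  -- apply the shifted Cor. 3.2 to an independent system of eigenclasses containing `y` (and `x` if `x ≠ 0`)
  have key : ∃ T : Set ℕ, T.Infinite ∧ ∀ ℓ ∈ T, Zhang2014.IsKolyvaginPrime (W.conductorNorm ℤ) W K p ℓ ∧
      k + j ≤ Zhang2014.kolyvaginIndex W p ℓ ∧ ∀ v : HeightOneSpectrum (𝓞 K), (ℓ : 𝓞 K) ∈ v.asIdeal →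
        addOrderOf (loc v x) = addOrderOf x ∧ addOrderOf (loc v y) = addOrderOf y := by
    by_cases hx0 : x = 0
    · -- the system `(y)`
      have hinf := h32S 1 ![y] (by intro i; fin_cases i; exact hy0)
        (by intro i; fin_cases i; exact ⟨-e, hey, hy⟩)
        (by
          intro a ha i
          fin_cases i
          exact addOrderOf_dvd_iff_zsmul_eq_zero.mpr (by simpa using ha : a 0 • y = 0))
        ![b'] (by intro i; fin_cases i; exact hb') ![b'] (fun _ ↦ le_rfl)
      refine ⟨_, hinf, fun ℓ hℓ ↦ ⟨hℓ.2.1, hℓ.2.2.1, fun v hv ↦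
        ⟨by rw [hx0, map_zero, addOrderOf_zero, addOrderOf_zero], ?_⟩⟩⟩
      rw [hb']
      exact addOrderOf_map_eq_of_forall_map_nsmul_eq_zero_iff (loc v) hp fun j' ↦ by
        rw [hloc v y j']; simpa using hℓ.2.2.2 0 v hv j'
    · -- the system `(x, y)`
      obtain ⟨a', -, ha'⟩ := hordpow x
      have hinf := h32S 2 ![x, y] (by intro i; fin_cases i; exacts [hx0, hy0])
        (by intro i; fin_cases i; exacts [⟨e, he, hx⟩, ⟨-e, hey, hy⟩])
        (by
          intro c hc i
          have hc' : c 0 • x + c 1 • y = 0 := by simpa [Fin.sum_univ_two] using hc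
          obtain ⟨h0, h1⟩ := dvd_of_zsmul_add_zsmul_eq_zero_of_eigen (conjAct W τ ((p ^ k : ℕ) : ℤ)) he
            hx hy (hcop2 x) (hcop2 y) hc'
          fin_cases i; exacts [h0, h1])
        ![a', b'] (by intro i; fin_cases i; exacts [ha', hb']) ![a', b'] (fun _ ↦ le_rfl)
      refine ⟨_, hinf, fun ℓ hℓ ↦ ⟨hℓ.2.1, hℓ.2.2.1, fun v hv ↦ ⟨?_, ?_⟩⟩⟩
      · rw [ha']
        exact addOrderOf_map_eq_of_forall_map_nsmul_eq_zero_iff (loc v) hp fun j' ↦ by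
          rw [hloc v x j']; simpa using hℓ.2.2.2 0 v hv j'
      · rw [hb']
        exact addOrderOf_map_eq_of_forall_map_nsmul_eq_zero_iff (loc v) hp fun j' ↦ by
          rw [hloc v y j']; simpa using hℓ.2.2.2 1 v hv j'
  obtain ⟨T, hT, hTprop⟩ := key
  obtain ⟨ℓ, hℓT, hbℓ⟩ := hT.exists_gt b
  exact ⟨ℓ, hbℓ, hTprop ℓ hℓT⟩

end Frame

/-! ### 3. On X9 Heegner frames (`p ∈ {5, 7}` good ordinary, `E[p]` irreducible, `ρ̄` not onto, `p` split) -/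

section Leaf

variable {W : WeierstrassCurve ℚ} [W.IsElliptic] [W.IsGloballyMinimal] {p : ℕ} [Fact p.Prime]

/-- **McCallum 1991 Cor. 3.2 ONE LEVEL DEEPER on X9 Heegner frames — UNCONDITIONAL, Zhang's
currency**: on `(E, p)` of class X9, `K` imaginary quadratic with the Heegner hypothesis for `N_E` and
`p` split, `c ≠ 1`, for non-zero independent `c`-eigenclasses `c_i ∈ H¹(K, E[p^M])` (`M ≥ 1`) of
orders `p^{M_i}` and `N_i ≤ M_i`: infinitely many Zhang–Kolyvagin primes of index `≥ M + k` with
`Frob ℓ = Frob ∞` on `E[p^{M+k}]` and `p^j c_{i,λ} = 0 ↔ N_i ≤ j`. §1 fed with `E(K)[p] = 0` (from (irr))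
and F's `ClassX9.cor32_localOrder_of_heegner` at level `p^{M+k}` ((Z), (S), (C) from the class, no `−1`,
no certificate). [cite: McCallumLMS1991, §3 Cor. 3.2, §4 Lemma 4.6] [cite: Jetchev2008, Lemma 5.1, Rem. 6.2] -/
theorem ClassX9.cor32_localOrder_shift_of_heegner (h : ClassX9 W p) (N : ℕ) [NeZero N] (K : Type)
    [Field K] [NumberField K] (hK : IsImaginaryQuadratic K)
    (hHN : SatisfiesHeegnerHypothesis (W.conductorNorm ℤ) K) (hHp : SatisfiesHeegnerHypothesis p K)
    (c : K ≃ₐ[ℚ] K) (hc : c ≠ 1) (M : ℕ) (hM : 1 ≤ M) (k : ℕ)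
    (r : ℕ) (cs : Fin r → galH1Torsion (W.baseChange K) ((p ^ M : ℕ) : ℤ)) (h0 : ∀ i, cs i ≠ 0)
    (hτ : ∀ i, ∃ e : ℤ, (e = 1 ∨ e = -1) ∧ conjAct W c ((p ^ M : ℕ) : ℤ) (cs i) = e • cs i)
    (hind : ∀ b : Fin r → ℤ, ∑ i, b i • cs i = 0 → ∀ i, (addOrderOf (cs i) : ℤ) ∣ b i)
    (Mi : Fin r → ℕ) (hMi : ∀ i, addOrderOf (cs i) = p ^ Mi i) (Nv : Fin r → ℕ) (hNv : ∀ i, Nv i ≤ Mi i) :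
    Set.Infinite {ℓ : ℕ | FrobEqFrobInfty W K (p ^ (M + k)) ℓ ∧
      Zhang2014.IsKolyvaginPrime N W K p ℓ ∧ M + k ≤ Zhang2014.kolyvaginIndex W p ℓ ∧
      ∀ i, ∀ v : HeightOneSpectrum (𝓞 K), (ℓ : 𝓞 K) ∈ v.asIdeal →
        ∀ j : ℕ, ((p ^ j : ℕ) : ℤ) • cs i ∈
            (W.baseChange K).torsionLocalKer (v.adicCompletion K) ((p ^ M : ℕ) : ℤ) ↔ Nv i ≤ j} :=
  cor32_localOrder_shift_of_cor32Frame N W K hK p Fact.out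
    (torsionBy_eq_bot_of_isImaginaryQuadratic_of_hasIrreducibleModPGaloisRep W K hK Fact.out h.irr)
    c M hM k
    (fun r' cs' h0' hτ' hind' Mi' hMi' Nv' hNv' ↦
      h.cor32_localOrder_of_heegner N K hK hHN hHp c hc (M + k) (le_trans hM (Nat.le_add_right M k))
        r' cs' h0' hτ' hind' Mi' hMi' Nv' hNv')
    r cs h0 hτ hind Mi hMi Nv hNv

/-- **[J] Lemma 6.1 DECOUPLED (level `p^k`, index `≥ k + j`) on X9 Heegner frames — the `h61` input
of the core-vertex walk, UNCONDITIONAL.** On `(E, p)` of class X9, `K` imaginary quadratic with the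
Heegner hypothesis for `N_E` and `p` split, complex conjugation `τ ≠ 1`, `k ≥ 1`, a shift `j`,
`τ`-eigenclasses `x` (sign `e`) and `y ≠ 0` (sign `−e`) in `H¹(K, E[p^k])`, any bound `b`: a
Zhang–Kolyvagin prime `ℓ > b` (for `N = N_E`) of index `M(ℓ) ≥ k + j` whose localisation preserves
the orders of `x` and `y` — tam3-p1's `Koly.exists_kolyvaginPrime_addOrderOf_localization_eq_shift`
with `ρ̄_{E,p}` onto replaced by the X9 frame; §2 over `ClassX9.cor32_localOrder_shift_of_heegner`.
[cite: Jetchev2008, Lemma 5.1 (p. 821), Rem. 6.2, Prop. 5.3] [cite: McCallumLMS1991, §3 Cor. 3.2, §4 Lemma 4.6] -/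
theorem ClassX9.exists_kolyvaginPrime_addOrderOf_localization_eq_shift_of_heegner (h : ClassX9 W p)
    [NeZero (W.conductorNorm ℤ)] (K : Type) [Field K] [NumberField K] (hK : IsImaginaryQuadratic K)
    (hHN : SatisfiesHeegnerHypothesis (W.conductorNorm ℤ) K) (hHp : SatisfiesHeegnerHypothesis p K)
    (τ : K ≃ₐ[ℚ] K) (hτ : τ ≠ 1) {k : ℕ} (hk : 1 ≤ k) (j : ℕ) {e : ℤ} (he : e = 1 ∨ e = -1)
    (x y : galH1Torsion (W.baseChange K) ((p ^ k : ℕ) : ℤ))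
    (hx : conjAct W τ ((p ^ k : ℕ) : ℤ) x = e • x) (hy : conjAct W τ ((p ^ k : ℕ) : ℤ) y = (-e) • y)
    (hy0 : y ≠ 0) (b : ℕ) :
    ∃ ℓ : ℕ, b < ℓ ∧ Zhang2014.IsKolyvaginPrime (W.conductorNorm ℤ) W K p ℓ ∧
      k + j ≤ Zhang2014.kolyvaginIndex W p ℓ ∧
      ∀ v : HeightOneSpectrum (𝓞 K), (ℓ : 𝓞 K) ∈ v.asIdeal →
        addOrderOf (galoisCohomology.localization
            ((W.baseChange K).torsionGaloisModule ((p ^ k : ℕ) : ℤ)) (Sum.inr v) 1 x) = addOrderOf x ∧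
        addOrderOf (galoisCohomology.localization
            ((W.baseChange K).torsionGaloisModule ((p ^ k : ℕ) : ℤ)) (Sum.inr v) 1 y) = addOrderOf y :=
  exists_kolyvaginPrime_addOrderOf_localization_eq_shift_of_cor32ShiftFrame W K p h.ne_two τ j
    (h.cor32_localOrder_shift_of_heegner (W.conductorNorm ℤ) K hK hHN hHp τ hτ k hk j) he x y hx hy hy0 b

/-! ### 4. The X10b twins at `p = 3` (`3` split in `K`) -/

/-- **McCallum 1991 Cor. 3.2 ONE LEVEL DEEPER on X10b Heegner frames with `3` split — UNCONDITIONAL,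
Zhang's currency** (`Irr W 3` from `ClassX10`; §1 over file F's `ClassX10.cor32_localOrder_of_heegner`),
for the core-vertex walk of the X10b Heegner road at `3` (`Theorems/PrintX10bHeegnerRoad`, crux J₃).
[cite: McCallumLMS1991, §3 Cor. 3.2, §4 Lemma 4.6] [cite: Jetchev2008, Lemma 5.1, Rem. 6.2] -/
theorem ClassX10.cor32_localOrder_shift_of_heegner (h : ClassX10 W p) (N : ℕ) [NeZero N] (K : Type)
    [Field K] [NumberField K] (hK : IsImaginaryQuadratic K)
    (hHN : SatisfiesHeegnerHypothesis (W.conductorNorm ℤ) K) (hHp : SatisfiesHeegnerHypothesis p K)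
    (c : K ≃ₐ[ℚ] K) (hc : c ≠ 1) (M : ℕ) (hM : 1 ≤ M) (k : ℕ)
    (r : ℕ) (cs : Fin r → galH1Torsion (W.baseChange K) ((p ^ M : ℕ) : ℤ)) (h0 : ∀ i, cs i ≠ 0)
    (hτ : ∀ i, ∃ e : ℤ, (e = 1 ∨ e = -1) ∧ conjAct W c ((p ^ M : ℕ) : ℤ) (cs i) = e • cs i)
    (hind : ∀ b : Fin r → ℤ, ∑ i, b i • cs i = 0 → ∀ i, (addOrderOf (cs i) : ℤ) ∣ b i)
    (Mi : Fin r → ℕ) (hMi : ∀ i, addOrderOf (cs i) = p ^ Mi i) (Nv : Fin r → ℕ) (hNv : ∀ i, Nv i ≤ Mi i) :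
    Set.Infinite {ℓ : ℕ | FrobEqFrobInfty W K (p ^ (M + k)) ℓ ∧
      Zhang2014.IsKolyvaginPrime N W K p ℓ ∧ M + k ≤ Zhang2014.kolyvaginIndex W p ℓ ∧
      ∀ i, ∀ v : HeightOneSpectrum (𝓞 K), (ℓ : 𝓞 K) ∈ v.asIdeal →
        ∀ j : ℕ, ((p ^ j : ℕ) : ℤ) • cs i ∈
            (W.baseChange K).torsionLocalKer (v.adicCompletion K) ((p ^ M : ℕ) : ℤ) ↔ Nv i ≤ j} :=
  cor32_localOrder_shift_of_cor32Frame N W K hK p Fact.out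
    (torsionBy_eq_bot_of_isImaginaryQuadratic_of_hasIrreducibleModPGaloisRep W K hK Fact.out h.irr)
    c M hM k
    (fun r' cs' h0' hτ' hind' Mi' hMi' Nv' hNv' ↦
      h.cor32_localOrder_of_heegner N K hK hHN hHp c hc (M + k) (le_trans hM (Nat.le_add_right M k))
        r' cs' h0' hτ' hind' Mi' hMi' Nv' hNv')
    r cs h0 hτ hind Mi hMi Nv hNv

/-- **[J] Lemma 6.1 DECOUPLED on X10b Heegner frames with `3` split — the `h61` input of the
core-vertex walk at `p = 3`, UNCONDITIONAL** (§2 over `ClassX10.cor32_localOrder_shift_of_heegner`).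
[cite: Jetchev2008, Lemma 5.1 (p. 821), Rem. 6.2, Prop. 5.3] [cite: McCallumLMS1991, §3 Cor. 3.2, §4 Lemma 4.6] -/
theorem ClassX10.exists_kolyvaginPrime_addOrderOf_localization_eq_shift_of_heegner (h : ClassX10 W p)
    [NeZero (W.conductorNorm ℤ)] (K : Type) [Field K] [NumberField K] (hK : IsImaginaryQuadratic K)
    (hHN : SatisfiesHeegnerHypothesis (W.conductorNorm ℤ) K) (hHp : SatisfiesHeegnerHypothesis p K)
    (τ : K ≃ₐ[ℚ] K) (hτ : τ ≠ 1) {k : ℕ} (hk : 1 ≤ k) (j : ℕ) {e : ℤ} (he : e = 1 ∨ e = -1)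
    (x y : galH1Torsion (W.baseChange K) ((p ^ k : ℕ) : ℤ))
    (hx : conjAct W τ ((p ^ k : ℕ) : ℤ) x = e • x) (hy : conjAct W τ ((p ^ k : ℕ) : ℤ) y = (-e) • y)
    (hy0 : y ≠ 0) (b : ℕ) :
    ∃ ℓ : ℕ, b < ℓ ∧ Zhang2014.IsKolyvaginPrime (W.conductorNorm ℤ) W K p ℓ ∧
      k + j ≤ Zhang2014.kolyvaginIndex W p ℓ ∧
      ∀ v : HeightOneSpectrum (𝓞 K), (ℓ : 𝓞 K) ∈ v.asIdeal →
        addOrderOf (galoisCohomology.localization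
            ((W.baseChange K).torsionGaloisModule ((p ^ k : ℕ) : ℤ)) (Sum.inr v) 1 x) = addOrderOf x ∧
        addOrderOf (galoisCohomology.localization
            ((W.baseChange K).torsionGaloisModule ((p ^ k : ℕ) : ℤ)) (Sum.inr v) 1 y) = addOrderOf y :=
  exists_kolyvaginPrime_addOrderOf_localization_eq_shift_of_cor32ShiftFrame W K p h.ne_two τ j
    (h.cor32_localOrder_shift_of_heegner (W.conductorNorm ℤ) K hK hHN hHp τ hτ k hk j) he x y hx hy hy0 b

end Leaf

end Literature.NumberTheory.EllipticCurves.Rank1Residual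

end
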